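/- Copyright: the b2b-balaban cell (near-miss cell 7), T⁴-continuum fan-out; row NE7b ROUND-2 swarm, seat
t4-ne7b-formalise-leaf-06 (gen 4) (road W-RP-VAR, sub-piece W3e file 2; booking claim table v3.35).  Released under the
licence of the surrounding project. -/
import Summits.QuantumFields.BalabanUV.T4Continuum.Support.HistoryChessboardRP
import Summits.QuantumFields.BalabanUV.T4Continuum.Support.HistoryRPBlocks

/-!
# Road W-RP-VAR, sub-piece W3e file 2: the level-0 RP-package KEYED BY BLOCK HYPERPLANES `(i, k)`

Summits-side support leaf of the T⁴-continuum cell (rung (B)+1 on a FINITE torus only; NOT infinite volume, NOT the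
mass gap, NOT the Clay statement; NOT a proof of the spine estimate NE7b).  Row NE7b, road **W-RP-VAR**, sub-piece W3e
(owner booking, claim table v3.35), file 2: a by-name COROLLARY of row W3c (`HistoryRPBase.rpPackage_wilson_theta`: the
Osterwalder–Seiler RP-package of the torus Wilson state at every fine hyperplane `(π, v)`) and file 1
(`HistoryRPBlocks.theta_swap_eq_configReflect`, `two_mul_cutShift_add_one`: at `(π, v) = (swap 0 i, cutShift b i k)` the
transported reflection IS the wall reflection `configReflect i (2kb − 1)` of the block cut `(i, k)`).  [folklore]
bookkeeping; those two files + W5 (`HistoryChessboardRP`, for the junction check) only; no `def`, no `[cite:]`, nothing of Bałaban instantiated or asserted.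

WHAT.  **`rpPackage_wilson_block`**: for the fine torus `GaugeConfig d (N·b) G` (`N` cells of `b` sites per direction,
`N` even, `ρ` continuous, `β ≥ 0`) and EVERY block hyperplane `(i, k)` of the cell torus `BlockIdx d N`, the five
sentences `mP_le ∕ θ_meas ∕ θ_pres ∕ θ_invol ∕ rp` of W4b′'s `CutoffReading` (resp. W4b's `EventReading`, W5's
`chessboardFields_of_isReflectionPositiveBdd`) for the level-0 state `wilsonMeasure ρ β`, the positive σ-algebra
`(piFinset posEdges).comap Φ_{swap 0 i, cutShift b i k}` (the links of the slab `x_i ∈ [kb, kb + Nb∕2 − 1]`, which contains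
the cells of `halfPlus N i k` — file 1's `piFinset_cellLinks_le`) and the reflection `configReflect i (2kb − 1)` (sites
`x_i ↦ 2kb − 1 − x_i`, carrying cell `c` onto `cellReflect i k c` — file 1's `cellOf_siteReflect`) — in the quantifier
shape `∀ (i : Fin d) (k : ZMod N), …` those structures display.  `even_mul_cells`: `Even N → Even (N·b)`.

HONEST SCOPE: the LEVEL-0 (pure Wilson) RP-package only; the road's state at cutoff `K` is the EXTENDED state (levels
`≤ K` by W3b's `rpPackage_level` on top of this), and the identification of the run's fine-link state with
`wilsonMeasure ρ β` on `GaugeConfig d (N·b) G` is the instantiating seat's displayed sentence; nothing of (VAR)∕(U1)∕(G2)∕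
(EXT)∕(LOC)∕(R-sym) is discharged for Bałaban's state; no exit ∕ socket ∕ `HistoryConstants` file touched (c3); no
constant specialised (c2∕c6).  NE7b NOT proved; spine 0∕9.  HONEST DEPENDENCY (cell): continuum YM on T⁴ ⇐ BetaPertH ∧
nine spine estimates (0/9 proved); BetaPertH ⇐ (D1) ∧ (D4) ∧ CAP+tail; G-an2-4 gates asym, D1 and NE2/3/4.  This file
changes none of it.
-/

open MeasureTheory Literature.Barriers.CriticalPhenomena.NonGibbs
open Literature.MathematicalPhysics.QuantumFieldTheory
open Literature.MathematicalPhysics.QuantumFieldTheory.LatticeRP (IsReflectionPositiveBdd)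
open Summit.QuantumFields.YangMills.Theorems.ContinuumLegGivenGap (configReflect)
open Summit.QuantumFields.BalabanUV.T4Continuum.HistoryRPBlocks

namespace Summit.QuantumFields.BalabanUV.T4Continuum.HistoryRPBlocksWilson

noncomputable section

variable {d N b Nc : ℕ} [NeZero d] [NeZero N] [NeZero b] {G : Type*} [Group G] [TopologicalSpace G]
  [IsTopologicalGroup G] [CompactSpace G] [MeasurableSpace G] [BorelSpace G] (ρ : G →* Matrix (Fin Nc) (Fin Nc) ℂ)

omit [NeZero N] [NeZero b] in
/-- An even number of cells per direction makes the fine side even (the parity the Osterwalder–Seiler theorem and the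
chessboard estimate ask for). [folklore] -/
theorem even_mul_cells (hN : Even N) : Even (N * b) := hN.mul_right b

/-- **THE LEVEL-0 RP-PACKAGE AT THE BLOCK HYPERPLANE `(i, k)`** of the cell torus `BlockIdx d N` (`N` cells of `b` fine
sites per direction): for `N` even, `ρ` continuous and `β ≥ 0`, the torus Wilson state on `GaugeConfig d (N·b) G` carries
the five sentences `mP_le`, `θ_meas`, `θ_pres`, `θ_invol`, `rp` for the positive σ-algebra
`(piFinset posEdges).comap Φ_{swap 0 i, cutShift b i k}` and the wall reflection `configReflect i (2kb − 1)` — row W3c's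
`rpPackage_wilson_theta` at `(swap 0 i, cutShift b i k)`, the reflection rewritten in closed form by file 1's
`theta_swap_eq_configReflect` ∕ `two_mul_cutShift_add_one`. [folklore] -/
theorem rpPackage_wilson_block (hN : Even N) (hρ : Continuous ρ) {β : ℝ} (hβ : 0 ≤ β) (i : Fin d) (k : ZMod N) :
    ((Filtration.piFinset (X := fun _ : Edge d (N * b) => G) WilsonRP.posEdges :
        MeasurableSpace (GaugeConfig d (N * b) G)).comap
          (fun U : GaugeConfig d (N * b) G =>
            configPerm (Equiv.swap 0 i).symm (torusConfigShift (-(cutShift b i k)) U))) ≤ MeasurableSpace.pi ∧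
      Measurable (configReflect i (2 * (((k.val * b : ℕ) : ZMod (N * b))) - 1) :
        GaugeConfig d (N * b) G → GaugeConfig d (N * b) G) ∧
      MeasurePreserving (configReflect i (2 * (((k.val * b : ℕ) : ZMod (N * b))) - 1))
        (wilsonMeasure (d := d) (L := N * b) ρ β) (wilsonMeasure (d := d) (L := N * b) ρ β) ∧
      ((configReflect i (2 * (((k.val * b : ℕ) : ZMod (N * b))) - 1) :
          GaugeConfig d (N * b) G → GaugeConfig d (N * b) G) ∘
        configReflect i (2 * (((k.val * b : ℕ) : ZMod (N * b))) - 1)) = id ∧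
      IsReflectionPositiveBdd (wilsonMeasure (d := d) (L := N * b) ρ β)
        ((Filtration.piFinset (X := fun _ : Edge d (N * b) => G) WilsonRP.posEdges :
            MeasurableSpace (GaugeConfig d (N * b) G)).comap
          (fun U : GaugeConfig d (N * b) G =>
            configPerm (Equiv.swap 0 i).symm (torusConfigShift (-(cutShift b i k)) U)))
        (configReflect i (2 * (((k.val * b : ℕ) : ZMod (N * b))) - 1)) := by
  have hΘ : (fun U : GaugeConfig d (N * b) G => torusConfigShift (cutShift b i k) (configPerm (Equiv.swap 0 i)
      (GaugeConfig.timeReflect (configPerm (Equiv.swap 0 i).symm (torusConfigShift (-(cutShift b i k)) U))))) =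
      configReflect i (2 * (((k.val * b : ℕ) : ZMod (N * b))) - 1) := by
    funext U
    rw [theta_swap_eq_configReflect, two_mul_cutShift_add_one]
  have h := HistoryRPBase.rpPackage_wilson_theta (d := d) (L := N * b) ρ (even_mul_cells hN) hρ hβ
    (Equiv.swap 0 i) (cutShift b i k)
  rw [hΘ] at h
  exact h

/-- **ALL BLOCK HYPERPLANES AT ONCE**, in the quantifier shape of W4b′'s `CutoffReading` ∕ W5's
`chessboardFields_of_isReflectionPositiveBdd` (`∀ (i : Fin d) (k : ZMod N)`): the five families for
`mP i k := (piFinset posEdges).comap Φ_{swap 0 i, cutShift b i k}` and `θ i k := configReflect i (2kb − 1)`. [folklore] -/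
theorem rpPackage_wilson_blocks (hN : Even N) (hρ : Continuous ρ) {β : ℝ} (hβ : 0 ≤ β) :
    (∀ (i : Fin d) (k : ZMod N),
      ((Filtration.piFinset (X := fun _ : Edge d (N * b) => G) WilsonRP.posEdges :
          MeasurableSpace (GaugeConfig d (N * b) G)).comap
            (fun U : GaugeConfig d (N * b) G =>
              configPerm (Equiv.swap 0 i).symm (torusConfigShift (-(cutShift b i k)) U))) ≤ MeasurableSpace.pi) ∧
    (∀ (i : Fin d) (k : ZMod N), Measurable (configReflect i (2 * (((k.val * b : ℕ) : ZMod (N * b))) - 1) :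
        GaugeConfig d (N * b) G → GaugeConfig d (N * b) G)) ∧
    (∀ (i : Fin d) (k : ZMod N), MeasurePreserving (configReflect i (2 * (((k.val * b : ℕ) : ZMod (N * b))) - 1))
        (wilsonMeasure (d := d) (L := N * b) ρ β) (wilsonMeasure (d := d) (L := N * b) ρ β)) ∧
    (∀ (i : Fin d) (k : ZMod N), ((configReflect i (2 * (((k.val * b : ℕ) : ZMod (N * b))) - 1) :
          GaugeConfig d (N * b) G → GaugeConfig d (N * b) G) ∘
        configReflect i (2 * (((k.val * b : ℕ) : ZMod (N * b))) - 1)) = id) ∧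
    (∀ (i : Fin d) (k : ZMod N), IsReflectionPositiveBdd (wilsonMeasure (d := d) (L := N * b) ρ β)
        ((Filtration.piFinset (X := fun _ : Edge d (N * b) => G) WilsonRP.posEdges :
            MeasurableSpace (GaugeConfig d (N * b) G)).comap
          (fun U : GaugeConfig d (N * b) G =>
            configPerm (Equiv.swap 0 i).symm (torusConfigShift (-(cutShift b i k)) U)))
        (configReflect i (2 * (((k.val * b : ℕ) : ZMod (N * b))) - 1))) :=
  ⟨fun i k => (rpPackage_wilson_block ρ hN hρ hβ i k).1, fun i k => (rpPackage_wilson_block ρ hN hρ hβ i k).2.1,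
    fun i k => (rpPackage_wilson_block ρ hN hρ hβ i k).2.2.1, fun i k => (rpPackage_wilson_block ρ hN hρ hβ i k).2.2.2.1,
    fun i k => (rpPackage_wilson_block ρ hN hρ hβ i k).2.2.2.2⟩

/-! ## Sanity: the chessboard fields of W5 for CELL-LOCAL INDICATORS at level 0 type-check from this package -/

/-- JUNCTION SHAPE (a type-check, nothing asserted beyond the package): W5's `chessboardFields_of_isReflectionPositiveBdd`
consumes exactly the five families of `rpPackage_wilson_blocks` (its remaining inputs — cell observables `b c`, their
positive-half measurability and reflection covariance — are the instantiating seat's, displayed here as hypotheses). -/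
example (hN : Even N) (hρ : Continuous ρ) {β : ℝ} (hβ : 0 ≤ β) (bc : BlockIdx d N → GaugeConfig d (N * b) G → ℝ)
    (hbP : ∀ (i : Fin d) (k : ZMod N), ∀ c ∈ halfPlus N i k,
      Measurable[((Filtration.piFinset (X := fun _ : Edge d (N * b) => G) WilsonRP.posEdges :
          MeasurableSpace (GaugeConfig d (N * b) G)).comap
        (fun U : GaugeConfig d (N * b) G =>
          configPerm (Equiv.swap 0 i).symm (torusConfigShift (-(cutShift b i k)) U)))] (bc c))
    (hb0 : ∀ c U, 0 ≤ bc c U) (hb1 : ∀ c U, bc c U ≤ 1)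
    (hcov : ∀ (i : Fin d) (k : ZMod N) (c : BlockIdx d N) (U : GaugeConfig d (N * b) G),
      bc c (configReflect i (2 * (((k.val * b : ℕ) : ZMod (N * b))) - 1) U) = bc (cellReflect i k c) U)
    (ψ : Finset (BlockIdx d N) → ℝ) (hψ : ∀ S, ψ S = ∫ U, ∏ c ∈ S, bc c U ∂(wilsonMeasure (d := d) (L := N * b) ρ β)) :
    (∀ S, 0 ≤ ψ S) ∧ ψ ∅ ≤ 1 ∧
      ∀ (i : Fin d) (k : ZMod N) (S : Finset (BlockIdx d N)), ψ S ^ 2 ≤ ψ (symP i k S) * ψ (symM i k S) := by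
  haveI := isProbabilityMeasure_wilsonMeasure (d := d) (L := N * b) ρ hρ β
  obtain ⟨h1, h2, h3, h4, h5⟩ := rpPackage_wilson_blocks (d := d) (b := b) ρ hN hρ hβ
  exact HistoryChessboardRP.chessboardFields_of_isReflectionPositiveBdd _ h1 _ h2 h3 h4 h5 hN bc hbP hb0 hb1 hcov ψ hψ

end

end Summit.QuantumFields.BalabanUV.T4Continuum.HistoryRPBlocksWilson
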